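import Mathlib.Topology.Algebra.InfiniteSum.NatInt
import Mathlib.Topology.Algebra.InfiniteSum.Order
import Mathlib.Topology.Algebra.InfiniteSum.Real
import Mathlib.Analysis.SpecificLimits.Basic
import Mathlib.Algebra.BigOperators.Field
import Mathlib.Tactic
import HarnessLib

/-!
# Kesten-type cylinder measures with a rate: the model-free total-variation core

Topic `Literature/Probability/RandomPlanarGeometry` (generic engine for the rate versions of Madras–Slade
Theorem 8.3.1 / the LSW half-space weak limit; companion of `SAWKestenBridgeMeasure.lean` §`MS831`, which
proves the LIMIT model-free, and of `SAWRatioUniform.lean`).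

Source: N. Madras, G. Slade, *The Self-Avoiding Walk* (1993), Theorem 8.3.1 and its proof, eqs.
(8.3.5)–(8.3.13) (book pp. 273–275): for an `m`-step walk `ω`, `P_{m,n}(ω) = Σ_{k=m}^{n} |E_k(ω)| w_{n-k}/w_n
→ Σ_k |E_k(ω)| μ^{-k}` by truncation at `J`, the ratio limit `w_{n-k}/w_n → μ^{-k}` on the head and Kesten's
relation on the tail — a LIMIT, no rate [MadrasSlade1993]; the half-space version is Lawler–Schramm–Werner
2004, Appendix A [LawlerSchrammWerner2004SAW].

## What is new in this file (not in print): the same proof SUMMED OVER THE CYLINDERS, with every lim sup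
replaced by an explicit error, for an abstract finite family of cylinders `ω ∈ S` with weights
`E ω k ≥ 0`, a positive sequence `w`, a remainder `R ω ≥ 0` and target values `Kc ω` (`HasSum (E ω k/μ^k) (Kc ω)`,
`Σ_ω Kc ω = 1`):
* `MS831Rate.tv_core` — if `Σ_ω (Σ_{k≤n} E ω k · w_{n-k} + R ω) = w_n` (total mass), `|μ^k w_{n-k}/w_n - 1| ≤ θ`
  for `k ≤ J` (uniform ratio) and `Σ_ω (Kc ω - Σ_{k≤J} E ω k/μ^k) ≤ T` (tail mass), then
  `Σ_ω |(Σ_{k≤n} E ω k · w_{n-k} + R ω)/w_n - Kc ω| ≤ 2θ + 2T`;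
* `MS831Rate.tail_mass_le` — the tail mass is `≤ m (1 - Σ_{j < J+2-m} λ_j μ^{-j})` as soon as
  `Σ_ω E ω k ≤ Σ_{i<m} b_i λ_{k-i}` (`k > J`), `b_i ≤ μ^i` and `Σ_j λ_j μ^{-j} = 1` (Kesten's relation);
* `MS831Rate.summable_cyl` — each cylinder series `Σ_k E ω k/μ^k` converges under the same domination.
Instances: bridges (`w = b`, `R = 0`: M–S Theorem 8.3.1 with a rate) and half-space walks (`w = h`,
`R` = the walks with no half-space renewal time; lane «pcv-sawmu» route R27.6, `SAWHalfSpaceKestenRate.lean`).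
-/

noncomputable section

open Finset Filter Topology
open scoped BigOperators

namespace Literature.Probability.RandomPlanarGeometry.SAW.MS831Rate

variable {ι : Type*}

/-- **The total-variation core, model-free.** For a finite family of cylinders `S` with weights
`E ω k ≥ 0`, remainders `R ω ≥ 0`, a positive sequence `w` and `μ > 0`: if the total mass is
`Σ_ω (Σ_{k≤n} E ω k · w_{n-k} + R ω) = w_n`, the targets satisfy `HasSum (k ↦ E ω k/μ^k) (Kc ω)` with
`Σ_ω Kc ω = 1`, the shifted ratios obey `|μ^k w_{n-k}/w_n - 1| ≤ θ` for `k ≤ J ≤ n`, and the tail mass is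
`Σ_ω (Kc ω - Σ_{k≤J} E ω k/μ^k) ≤ T`, then `Σ_ω |P_n(ω) - Kc ω| ≤ 2θ + 2T` where
`P_n(ω) = (Σ_{k≤n} E ω k · w_{n-k} + R ω)/w_n`.
[cite: MadrasSlade1993, Theorem 8.3.1 (proof, eqs. (8.3.7)–(8.3.13); quantitative form, derived, model-free)] -/
theorem tv_core (S : Finset ι) (E : ι → ℕ → ℝ) (Kc R : ι → ℝ) (w : ℕ → ℝ) {μ θ T : ℝ} {J n : ℕ}
    (hμ : 0 < μ) (hw : ∀ k, 0 < w k) (hE : ∀ ω ∈ S, ∀ k, 0 ≤ E ω k) (hR : ∀ ω ∈ S, 0 ≤ R ω)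
    (hJn : J ≤ n)
    (htot : ∑ ω ∈ S, (∑ k ∈ Finset.range (n + 1), E ω k * w (n - k) + R ω) = w n)
    (hK : ∀ ω ∈ S, HasSum (fun k => E ω k / μ ^ k) (Kc ω)) (hnorm : ∑ ω ∈ S, Kc ω = 1)
    (hθ : ∀ k, k ≤ J → |μ ^ k * w (n - k) / w n - 1| ≤ θ)
    (htail : ∑ ω ∈ S, (Kc ω - ∑ k ∈ Finset.range (J + 1), E ω k / μ ^ k) ≤ T) :
    ∑ ω ∈ S, |(∑ k ∈ Finset.range (n + 1), E ω k * w (n - k) + R ω) / w n - Kc ω| ≤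
      2 * θ + 2 * T := by
  -- notation: `P` the cylinder probabilities, `Hd` their heads `k ≤ J`, `KH` the heads of the targets
  set P : ι → ℝ := fun ω => (∑ k ∈ range (n + 1), E ω k * w (n - k) + R ω) / w n with hP
  set Hd : ι → ℝ := fun ω => ∑ k ∈ range (J + 1), E ω k * w (n - k) / w n with hHd
  set KH : ι → ℝ := fun ω => ∑ k ∈ range (J + 1), E ω k / μ ^ k with hKH
  have hwn := hw n
  have hθ0 : 0 ≤ θ := by
    have h0 := hθ 0 (Nat.zero_le _)
    rw [pow_zero, one_mul, Nat.sub_zero, div_self hwn.ne', sub_self, abs_zero] at h0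
    exact h0
  -- per-cylinder facts
  have hKT : ∀ ω ∈ S, KH ω ≤ Kc ω := fun ω hω =>
    sum_le_hasSum (range (J + 1)) (fun k _ => div_nonneg (hE ω hω k) (pow_nonneg hμ.le k)) (hK ω hω)
  have hRest : ∀ ω ∈ S, Hd ω ≤ P ω := by
    intro ω hω
    have h1 : ∑ k ∈ range (J + 1), E ω k * w (n - k) ≤ ∑ k ∈ range (n + 1), E ω k * w (n - k) :=
      Finset.sum_le_sum_of_subset_of_nonneg (range_mono (by omega))
        fun k _ _ => mul_nonneg (hE ω hω k) (hw _).le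
    have h2 : Hd ω = (∑ k ∈ range (J + 1), E ω k * w (n - k)) / w n := by
      rw [hHd]; dsimp only; rw [Finset.sum_div]
    rw [h2, hP]; dsimp only
    exact div_le_div_of_nonneg_right (by linarith [hR ω hω]) hwn.le
  have hHead : ∀ ω ∈ S, |Hd ω - KH ω| ≤ θ * KH ω := by
    intro ω hω
    rw [hHd, hKH]; dsimp only
    rw [← Finset.sum_sub_distrib, Finset.mul_sum]
    refine (abs_sum_le_sum_abs _ _).trans (Finset.sum_le_sum fun k hk => ?_)
    have hkJ : k ≤ J := by have := mem_range.1 hk; omega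
    have hμk : 0 < μ ^ k := pow_pos hμ k
    have hid : E ω k * w (n - k) / w n - E ω k / μ ^ k =
        E ω k / μ ^ k * (μ ^ k * w (n - k) / w n - 1) := by
      rw [mul_sub, mul_one]
      congr 1
      field_simp
    rw [hid, abs_mul, abs_of_nonneg (div_nonneg (hE ω hω k) hμk.le)]
    calc E ω k / μ ^ k * |μ ^ k * w (n - k) / w n - 1| ≤ E ω k / μ ^ k * θ :=
          mul_le_mul_of_nonneg_left (hθ k hkJ) (div_nonneg (hE ω hω k) hμk.le)
      _ = θ * (E ω k / μ ^ k) := by ring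
  have hHead' : ∀ ω ∈ S, KH ω - θ * KH ω ≤ Hd ω := by
    intro ω hω
    have h1 := (abs_le.1 (hHead ω hω)).1
    linarith
  -- summed facts
  have hSP : ∑ ω ∈ S, P ω = 1 := by
    rw [hP]; dsimp only
    rw [← Finset.sum_div, htot, div_self hwn.ne']
  have hSKH : ∑ ω ∈ S, KH ω ≤ 1 := hnorm ▸ Finset.sum_le_sum hKT
  have hSKT : 1 - ∑ ω ∈ S, KH ω ≤ T := by
    have h1 : ∑ ω ∈ S, (Kc ω - KH ω) = 1 - ∑ ω ∈ S, KH ω := by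
      rw [Finset.sum_sub_distrib, hnorm]
    linarith [htail]
  have hSHd : ∑ ω ∈ S, KH ω - θ * ∑ ω ∈ S, KH ω ≤ ∑ ω ∈ S, Hd ω := by
    rw [Finset.mul_sum, ← Finset.sum_sub_distrib]
    exact Finset.sum_le_sum hHead'
  -- pointwise triangle inequality `|P - Kc| ≤ |Hd - KH| + (P - Hd) + (Kc - KH)`
  have hpt : ∀ ω ∈ S, |P ω - Kc ω| ≤ θ * KH ω + (P ω - Hd ω) + (Kc ω - KH ω) := by
    intro ω hω
    have h1 := abs_le.1 (hHead ω hω)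
    have h2 := hRest ω hω
    have h3 := hKT ω hω
    rw [abs_le]
    constructor <;> linarith [h1.1, h1.2]
  calc ∑ ω ∈ S, |P ω - Kc ω| ≤ ∑ ω ∈ S, (θ * KH ω + (P ω - Hd ω) + (Kc ω - KH ω)) :=
        Finset.sum_le_sum hpt
    _ = θ * ∑ ω ∈ S, KH ω + (∑ ω ∈ S, P ω - ∑ ω ∈ S, Hd ω) +
          (∑ ω ∈ S, Kc ω - ∑ ω ∈ S, KH ω) := by
        rw [Finset.sum_add_distrib, Finset.sum_add_distrib, Finset.sum_sub_distrib,
          Finset.sum_sub_distrib, Finset.mul_sum]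
    _ ≤ 2 * θ + 2 * T := by
        rw [hSP, hnorm]
        have h4 : θ * ∑ ω ∈ S, KH ω ≤ θ := by nlinarith [hSKH, hθ0]
        linarith [hSKT, hSHd, h4]

/-- **The tail mass, model-free.** If `HasSum (k ↦ E ω k/μ^k) (Kc ω)` for `ω ∈ S`, the summed weights
beyond `J` are dominated `Σ_ω E ω k ≤ Σ_{i<m} b_i λ_{k-i}` (`k > J`, with `m ≤ J + 1`), `b_i ≤ μ^i`
and `λ ≥ 0` has `Σ_j λ_j μ^{-j} = 1` (Kesten's relation), then
`Σ_ω (Kc ω - Σ_{k≤J} E ω k/μ^k) ≤ m · (1 - Σ_{j < J+2-m} λ_j μ^{-j})`.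
[cite: MadrasSlade1993, Theorem 8.3.1 (proof, eqs. (8.3.8), (8.3.12)–(8.3.13); quantitative form, derived, model-free)] -/
theorem tail_mass_le (S : Finset ι) (E : ι → ℕ → ℝ) (Kc : ι → ℝ) {μ : ℝ} (hμ : 0 < μ)
    (b lam : ℕ → ℝ) {m J : ℕ} (hmJ : m ≤ J + 1)
    (hK : ∀ ω ∈ S, HasSum (fun k => E ω k / μ ^ k) (Kc ω))
    (hlam : ∀ j, 0 ≤ lam j) (hp : HasSum (fun j => lam j / μ ^ j) 1)
    (hb : ∀ i, b i ≤ μ ^ i)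
    (hA : ∀ k, J < k → ∑ ω ∈ S, E ω k ≤ ∑ i ∈ Finset.range m, b i * lam (k - i)) :
    ∑ ω ∈ S, (Kc ω - ∑ k ∈ Finset.range (J + 1), E ω k / μ ^ k) ≤
      m * (1 - ∑ j ∈ Finset.range (J + 2 - m), lam j / μ ^ j) := by
  set p : ℕ → ℝ := fun j => lam j / μ ^ j with hpdef
  have hp0 : ∀ j, 0 ≤ p j := fun j => div_nonneg (hlam j) (pow_nonneg hμ.le j)
  -- the left side is the value of the series `Σ_k Σ_ω E ω (k+J+1)/μ^{k+J+1}`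
  have hL : HasSum (fun k => ∑ ω ∈ S, E ω (k + (J + 1)) / μ ^ (k + (J + 1)))
      (∑ ω ∈ S, (Kc ω - ∑ k ∈ range (J + 1), E ω k / μ ^ k)) :=
    hasSum_sum fun ω hω => (hasSum_nat_add_iff' (J + 1)).2 (hK ω hω)
  -- the dominating series `Σ_{i<m} u_i p_{k+J+1-i}`, `u_i = b_i μ^{-i} ≤ 1`
  set u : ℕ → ℝ := fun i => b i / μ ^ i with hudef
  have hu1 : ∀ i, u i ≤ 1 := fun i => by
    rw [hudef]; dsimp only
    rw [div_le_one (pow_pos hμ i)]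
    exact hb i
  have hG : HasSum (fun k => ∑ i ∈ range m, u i * p (k + (J + 1 - i)))
      (∑ i ∈ range m, u i * (1 - ∑ j ∈ range (J + 1 - i), p j)) :=
    hasSum_sum fun i _ => ((hasSum_nat_add_iff' (J + 1 - i)).2 hp).mul_left (u i)
  -- termwise comparison
  have hle : ∀ k, ∑ ω ∈ S, E ω (k + (J + 1)) / μ ^ (k + (J + 1)) ≤
      ∑ i ∈ range m, u i * p (k + (J + 1 - i)) := by
    intro k
    rw [← Finset.sum_div, div_le_iff₀ (pow_pos hμ _), Finset.sum_mul]
    refine (hA (k + (J + 1)) (by omega)).trans (Finset.sum_le_sum fun i hi => ?_)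
    have him : i < m := mem_range.1 hi
    have hsub : k + (J + 1) - i = k + (J + 1 - i) := by omega
    have hpow : μ ^ (k + (J + 1)) = μ ^ i * μ ^ (k + (J + 1 - i)) := by
      rw [← pow_add]; congr 1; omega
    rw [hsub, hpow, hudef, hpdef]; dsimp only
    have hμi := pow_pos hμ i
    have hμr := pow_pos hμ (k + (J + 1 - i))
    rw [show b i / μ ^ i * (lam (k + (J + 1 - i)) / μ ^ (k + (J + 1 - i))) * (μ ^ i * μ ^ (k + (J + 1 - i))) =
      b i * lam (k + (J + 1 - i)) by field_simp]
  refine (hasSum_le hle hL hG).trans ?_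
  -- `Σ_{i<m} u_i (1 - F_{J+1-i}) ≤ m (1 - F_{J+2-m})`
  have hF1 : ∀ N, ∑ j ∈ range N, p j ≤ 1 := fun N => sum_le_hasSum (range N) (fun j _ => hp0 j) hp
  calc ∑ i ∈ range m, u i * (1 - ∑ j ∈ range (J + 1 - i), p j)
      ≤ ∑ i ∈ range m, (1 - ∑ j ∈ range (J + 2 - m), p j) := by
        refine Finset.sum_le_sum fun i hi => ?_
        have him : i < m := mem_range.1 hi
        have hmono : ∑ j ∈ range (J + 2 - m), p j ≤ ∑ j ∈ range (J + 1 - i), p j :=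
          Finset.sum_le_sum_of_subset_of_nonneg (range_mono (by omega)) fun j _ _ => hp0 j
        have h1 : 0 ≤ 1 - ∑ j ∈ range (J + 1 - i), p j := by linarith [hF1 (J + 1 - i)]
        calc u i * (1 - ∑ j ∈ range (J + 1 - i), p j) ≤ 1 * (1 - ∑ j ∈ range (J + 1 - i), p j) :=
              mul_le_mul_of_nonneg_right (hu1 i) h1
          _ ≤ 1 - ∑ j ∈ range (J + 2 - m), p j := by linarith
    _ = m * (1 - ∑ j ∈ range (J + 2 - m), p j) := by
        rw [Finset.sum_const, card_range, nsmul_eq_mul]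

/-- **Each cylinder series converges** under the summed domination: if `Σ_ω E ω k ≤ Σ_{i<m} b_i λ_{k-i}`
for all `k`, `b_i ≤ μ^i`, `λ ≥ 0`, `λ_0 = 0` and `Σ_j λ_j μ^{-j} = 1`, then `k ↦ E ω k/μ^k` is summable
for every `ω ∈ S` (domination by the finitely many shifted Kesten series).
[cite: MadrasSlade1993, Theorem 8.3.1 (proof, eqs. (8.3.6), (8.3.8); model-free)] -/
theorem summable_cyl (S : Finset ι) (E : ι → ℕ → ℝ) {μ : ℝ} (hμ : 0 < μ) (b lam : ℕ → ℝ) (m : ℕ)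
    (hE : ∀ ω ∈ S, ∀ k, 0 ≤ E ω k) (hlam : ∀ j, 0 ≤ lam j) (hlam0 : lam 0 = 0)
    (hp : HasSum (fun j => lam j / μ ^ j) 1) (hb : ∀ i, b i ≤ μ ^ i)
    (hA : ∀ k, ∑ ω ∈ S, E ω k ≤ ∑ i ∈ Finset.range m, b i * lam (k - i)) :
    ∀ ω ∈ S, Summable (fun k => E ω k / μ ^ k) := by
  intro ω hω
  set p : ℕ → ℝ := fun j => lam j / μ ^ j with hpdef
  -- the shifted Kesten series are summable
  have hsh : ∀ i, Summable (fun k => p (k - i)) := by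
    intro i
    have h2 : Summable (fun n => (fun k => p (k - i)) (n + i)) := by
      refine hp.summable.congr fun n => ?_
      simp only [Nat.add_sub_cancel]
    exact (summable_nat_add_iff i).mp h2
  have hdom : Summable (fun k => ∑ i ∈ range m, p (k - i)) := summable_sum fun i _ => hsh i
  refine Summable.of_nonneg_of_le (fun k => div_nonneg (hE ω hω k) (pow_nonneg hμ.le k))
    (fun k => ?_) hdom
  have h1 : E ω k ≤ ∑ ω' ∈ S, E ω' k :=
    Finset.single_le_sum (f := fun ω' => E ω' k) (fun ω' hω' => hE ω' hω' k) hω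
  have hμk := pow_pos hμ k
  calc E ω k / μ ^ k ≤ (∑ i ∈ range m, b i * lam (k - i)) / μ ^ k :=
        div_le_div_of_nonneg_right (h1.trans (hA k)) hμk.le
    _ = ∑ i ∈ range m, b i * lam (k - i) / μ ^ k := Finset.sum_div _ _ _
    _ ≤ ∑ i ∈ range m, p (k - i) := Finset.sum_le_sum fun i _ => ?_
  rw [hpdef]; dsimp only
  rcases Nat.lt_or_ge k i with hik | hik
  · have hki : k - i = 0 := Nat.sub_eq_zero_of_le hik.le
    rw [hki, hlam0]
    simp
  · have hpow : μ ^ k = μ ^ i * μ ^ (k - i) := by rw [← pow_add, Nat.add_sub_cancel' hik]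
    rw [hpow, mul_div_mul_comm]
    have hμr := pow_pos hμ (k - i)
    calc b i / μ ^ i * (lam (k - i) / μ ^ (k - i)) ≤ 1 * (lam (k - i) / μ ^ (k - i)) :=
          mul_le_mul_of_nonneg_right ((div_le_one (pow_pos hμ i)).2 (hb i))
            (div_nonneg (hlam _) hμr.le)
      _ = lam (k - i) / μ ^ (k - i) := one_mul _

end Literature.Probability.RandomPlanarGeometry.SAW.MS831Rate

end
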